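import Summits.Ventures.HSemireg.Pad4TowerRuleDMu4Dual
import Summits.Ventures.HSemireg.Pad4TowerA2IMu4

/-!
# Venture HSemireg — PAD-4: LEMMA SAFE2 (soundness of the certified X-PHASE alternation) on 𝔅(μ₄), PROVED for the typed RULE D

HONEST FRAMING. Lean index of the computation cell `pub-hsemireg` (S4-PUSH, H2 door PAD-4), typed by the Ventures-side typer
`hodge-lit-semireg-typer-2` (g3), on line stmt-HodgeConjecture-18881 ∕ `Cruxes/BlochSeedDiscOne/Lines/birth.lean` 814a6a70c14e831a ∕
`stub_rung_pad4_seedAt` (screens (U) closure rules + (E1) off-diagonal X-PHASE; card v4.1 rows «typer-2 → (U)», «gs-eng-2 E-entries»,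
W3∕W5–W8). WHAT THIS FILE IS: the SOUNDNESS HALF of the cell's X-static screen — gs-eng-2 g50's **LEMMA SAFE2** («support-relative
persistence certificate», `general-structure/LEMMA-SAFE2-gs2g50.md` 86089cd465aa28ed; pencil, hostile reads ×2: s4-ref-2 g21, s4-ref g81)
— as a KERNEL THEOREM about finite 𝔅(μ₄) configurations (`Pad4TowerCrossPhase.MConfig`), the predicates typed LITERALLY from the engine
code of record (`xgen.py` 4d8a39e1321a726d `XGen.kill` reading 'p', `xrel.py` 231388c99fa8f64d `lethal_without_u`, `xtwo.py`
7c088360043cc0d5 literal dual), over the typed RULE D of row 771 (`Pad4TowerRuleDMu4.RuleDMu4Closed`). The machine fixpoints themselves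
(census entries at ◇₄ … ◇₁₄, class level) are NOT reproduced here; what is proved is the sentence that makes them upper bounds.

TEXT OF RECORD (86089cd465aa28ed, §LEMMA, verbatim): «Let T be an admissible support and suppose T ⊆ S_n. If a certified kill
(Z; σ, u, f) fires in S_n, then Z ∉ T. Consequently T ⊆ S_{n+1} (the RULE-D core of a set containing T contains T, RULE D being monotone
in the partner set), and by induction every admissible support inside S₀ is contained in the fixpoint — in whatever order certified kills
are applied.» ADMISSIBLE (§Setting): (S-i) RULE-D-closed, (S-ii±) no E− instance and no mirror instance of LEMMA X-PHASE (reading p)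
fires, (S-iii) G-invariant. CERTIFIED: the instance fires in S_n and (C1) every sibling used lies in the G-orbit of Z, (C2) support-relative
lethality. PROOF (three steps, followed line by line below): (1) absence is inherited by T ⊆ S_n; (2) RULE D at Z in T with W_f(Z) = ∅ and
(C2) forces a u-partner of Z inside T; (3) every such partner was pinned in S_n by a sibling in Z's orbit, present in T by (S-iii), with
inherited absence conditions — the instance fires in T, contradicting (S-ii). Mirror case: the same in the literal dual.

THE TYPED OBJECTS. §1 `XInstP C Z σ u f` — the E− INSTANCE IN READING p (participant-exact), clause by clause from `XGen.kill`: `Z_σ`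
charged; `f ≠ σ`; (P1) a `u`-partner `q = Z(σ ↦ Z_σ − d·n_u)` PRESENT (`UPartner`, `d ≥ 1`); (A1) `WfEmpty`: no present (r1) partner of `Z` on
`f` and no present (r2a) partner touching `f` («strictly null-below» = `NullBelow`, ANY null direction, Pythagorean included, as `null_dir`);
and EVERY present `u`-partner PINNED (`PinnedP`): a sibling `n = Z(σ ↦ q_σ + e·n_w) ∈ E₋`, `w ≠ u` (`Sibling`), (A2a) no `w`-companion
strictly between (`NoCompanion`), (A2b) `HeOkP` = `He_ok` mode p (a present `P′ = Z(σ ↦ y)`, `y ≠ Z_σ`, with `y ≤ n_σ` and `y − Z_σ` not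
timelike lies in `q_σ + C̄⁺`), (A2c) `HbOkP` = `Hb_ok` mode p (no present `P′` agreeing with `Z` off `{σ,f}` with `P′_f` strictly null-below
`Z_f`, `P′_σ ≤ n_σ`, `P′_σ − Z_σ` not timelike). THIS IS NOT `Pad4TowerCrossPhase.XPhaseDeadMu4` (§22 v2.3 VERBATIM, hostile read ref g16
l.30496: «the text of record has NO demand hypothesis, so a `Demanded` conjunct would DEVIATE from verbatim»): reading p ADDS (A1) and
RESTRICTS (H-e′)∕(H-b) to participants; `instP_ne_xPhaseDeadMu4` below exhibits a configuration separating them through (A1). Both are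
typed objects of record; neither is asserted to be «the» (E1) statement (pencil). §2 `XKillCert orb S Z σ u f` — the CERTIFIED kill:
the instance in `S`, (C1) as «the sibling `n` satisfies `orb Z n`» for a closure relation `orb` under which admissible supports are closed
(SAFE2 REMARK (ii): «for a support invariant under a subgroup G′ ⊂ G the same proof works with G′-orbit» — the theorem is stated for ANY
`orb`; the engines' `orb` is the G-orbit key `GKeyRel` of `Pad4TowerRuleDMu4Dual`), and **(C2) IN FRAME FORM** `LethalWithoutU`: some
adapted coordinate `a` of `Z_σ` and `b` of `Z_f` with unequal values such that every direction `r ≠ a + 2` in which `Z` is served below on `σ`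
IN `S` is `u`. FLAG C2: `xrel.py` evaluates (C2) as the EXACT ℚ(i) rank test «pair image of (σ,f) not absorbed by the legs of the present
non-u σ-directions»; the frame form is its reading through the same PAIR-IMAGE dictionary by which `RuleDMu4N` reads the exact diagonal
criterion (PAD4-BALANCED §1′, pencil + exact checks; `Pad4TowerRuleDMu4` FLAG F-1) — typed ≠ the rank test, equal to it exactly where
`RuleDMu4N` equals the exact criterion. §3 **`safe2N`** (the LEMMA, `N`-side) and **`safe2P`** (mirror kills = certified kills in the
literal dual `MConfig.dual h`, xtwo.py; via `ruleDMu4P_dual`). §4 `XAdmissible orb h T` ((S-i) `RuleDMu4Closed`, (S-ii±) no `XInstP` in `T`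
and in `T^∨`, (S-iii) `orb`-closed, stated for `T` and for `T^∨`), `CertStage` (one alternation step: `S′ ⊆ S`, every deleted class failed
RULE D in `S` or was certified-killed in `S` ∕ `S^∨`), **`XAdmissible.sub_of_certStage`** («T ⊆ S_{n+1}») and **`XAdmissible.sub_stage`**
(the induction over any sequence of certified stages); `xAdmissible_of_gKeyRel` assembles (S-iii) for the engines' key from closure of
the two levels (`gKeyRel_closed_dual_lower`). §5 kernel probes (`decide`): the instrumented column of `Pad4TowerCrossPhase` (kit j275278) is a
CERTIFIED reading-p kill with `orb = GKeyRel`; the (A1) separation from `XPhaseDeadMu4`.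

WHAT IS NOT HERE ∕ NOT IN LEAN. The (E1)-meaning of an instance (LEMMA X-PHASE §22, pencil ×2 (i)(ii) ∕ ×1 (iii)); the identification
of `RuleDMu4N` ∕ `LethalWithoutU` with the exact rank tests (pencil dictionary + offline checks, as in row 771); the machine fixpoints,
orbit enumeration, alphabets, heights `◇_m`; FC1, Ψ, A∪2I′, PSC, X∞ (other files). «Admissible» here is the STATIC-SCREEN notion of
SAFE2 (RULE D + two-sided X-clean + G), not `AdmissibleMu4` of the X∞ files. Nothing is a statement about a variety, a sheaf, `σ`, a seed
or an abelian variety; NOTHING HERE SAYS THAT HC ∕ HC_CM ∕ HC_AV ∕ W₆ ∕ HC_Kum4Type HOLDS OR FAILS; census-neutral. No `instance`, no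
notation, no named fact, 0 `sorry`; axioms standard. Typed ≠ proved ≠ endorsed.

SOURCES (sha16): `general-structure/LEMMA-SAFE2-gs2g50.md` 86089cd465aa28ed (§Setting, §certificate, §LEMMA, REMARKS (i)–(iv));
`general-structure/gs2/g49/xinf/xgen.py` 4d8a39e1321a726d (l.52 `W_f_empty`, l.62 `He_ok`, l.71 `Hb_ok`, l.91–134 `kill`), `g50/xinf/xrel.py`
231388c99fa8f64d (l.31–44), `g49/xinf/xtwo.py` 7c088360043cc0d5 (header, `dual_letter`); verdicts s4-ref-2 g21 ∕ s4-ref g81 (file names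
`VERDICT-LEMMA-SAFE2-…`); PAD4-BALANCED-search-1.md v2.3 acd94669f555557a §22 (the instance's pencil meaning); `Pad4TowerCrossPhase.lean`
8f09792281b0723a (p540496), `Pad4TowerRuleDMu4.lean` 7f3a78a9d76f5e0c (p551028), `Pad4TowerA2IMu4.lean` 62a434f6c034eb9e (p555844, `Timelike`),
`Pad4TowerRuleDMu4Dual.lean` (this typer, companion).
-/

namespace Summit.Ventures.HSemireg.Pad4Tower

open Finset

/-! ## §1 The E− instance of LEMMA X-PHASE in reading p (xgen.py `XGen.kill`, mode 'p') -/

/-- `y` lies STRICTLY NULL-BELOW `x`: `x − y` is a non-zero future null vector, `Δα > 0 ∧ |Δβ|² = Δα²` (xinf.py `null_dir(x, y) is not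
None`; ANY null direction — the μ₄ ones and the Pythagorean ones). -/
abbrev NullBelow (y x : BPoint) : Prop :=
  y.1 < x.1 ∧ (x.2.1 - y.2.1) ^ 2 + (x.2.2 - y.2.2) ^ 2 = (x.1 - y.1) ^ 2

/-- **(A1) `W_f(Z) = ∅`** (xgen.py `W_f_empty`): no present `P`-cell is an (r1) partner of `Z` on `f` (`P = Z(f ↦ y)`, `y` strictly
null-below `Z_f`), and none is an (r2a) partner touching `f` (`P = Z(f ↦ y, g ↦ y′)`, both strictly null-below). -/
abbrev WfEmpty (C : MConfig) (Z : MCell) (f : Fin 4) : Prop :=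
  ∀ P ∈ C.upper, NullBelow (P f) (Z f) → ¬ MAgree P Z f ∧ ∀ g, g ≠ f → MAgree2 P Z f g → ¬ NullBelow (P g) (Z g)

/-- **(A2b) (H-e′) participant-exact** (xgen.py `He_ok`, mode 'p') at the partner `q` with sibling `n`: a present `P′ = Z(σ ↦ y)`,
`y ≠ Z_σ`, that COUNTS as a participant of the pin row — `y ≤ n_σ` (causally) and `y − Z_σ` not timelike — has `y ∈ q_σ + C̄⁺`. -/
abbrev HeOkP (C : MConfig) (Z q n : MCell) (σ : Fin 4) : Prop :=
  ∀ P ∈ C.upper, MAgree P Z σ → P σ ≠ Z σ → Effective (bsub (n σ) (P σ)) → ¬ Timelike (bsub (P σ) (Z σ)) →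
    Effective (bsub (P σ) (q σ))

/-- **(A2c) (H-b) participant-exact** (xgen.py `Hb_ok`, mode 'p') at `(f, n)`: no present `P′` agreeing with `Z` off `{σ, f}` with
`P′_f` strictly null-below `Z_f`, `P′_σ ≤ n_σ` (causally) and `P′_σ − Z_σ` not timelike. -/
abbrev HbOkP (C : MConfig) (Z n : MCell) (σ f : Fin 4) : Prop :=
  ∀ P ∈ C.upper, MAgree2 P Z σ f → NullBelow (P f) (Z f) → Effective (bsub (n σ) (P σ)) → Timelike (bsub (P σ) (Z σ))

/-- the PIN of one `u`-partner `q` of `Z` on `σ` in reading p (`u = i^k`): a sibling server `n ∈ E₋` of `q` in a direction `w ≠ u`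
with (A2a) no `w`-companion strictly below it, (A2b) and (A2c). -/
abbrev PinnedP (C : MConfig) (Z q : MCell) (σ k f : Fin 4) : Prop :=
  ∃ n ∈ C.lower, ∃ k' : Fin 4, k' ≠ k ∧ Sibling q n σ k' ∧ NoCompanion C q n σ k' ∧ HeOkP C Z q n σ ∧ HbOkP C Z n σ f

/-- **the E− INSTANCE `(σ, u, f)` of LEMMA X-PHASE on the `N`-cell `Z`, READING p** (xgen.py `XGen.kill`): `Z_σ` charged, `f ≠ σ`,
(P1) some `u`-partner present, (A1) `W_f(Z) = ∅`, and every present `u`-partner pinned. -/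
abbrev XInstP (C : MConfig) (Z : MCell) (σ k f : Fin 4) : Prop :=
  ¬ isApex (Z σ) ∧ σ ≠ f ∧ (∃ q ∈ C.upper, UPartner Z q σ k) ∧ WfEmpty C Z f ∧
    ∀ q ∈ C.upper, UPartner Z q σ k → PinnedP C Z q σ k f

/-! ## §2 Certified kills: (C1) sibling in the orbit, (C2) support-relative lethality in frame form (xrel.py safe2) -/

/-- **(C2) SUPPORT-RELATIVE LETHALITY, frame form**: adapted coordinates `a` of `Z_σ` and `b` of `Z_f` with unequal values such that
every direction `r ≠ a + 2` in which `Z` is served below on `σ` in `S` is `u` (so the non-`u` legs present in `S` do not settle `(σ, a)`). -/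
abbrev LethalWithoutU (S : MConfig) (Z : MCell) (σ k f : Fin 4) : Prop :=
  ∃ a b : Fin 4, Adapted (Z σ) a ∧ Adapted (Z f) b ∧ coord (Z σ) a ≠ coord (Z f) b ∧
    ∀ r : Fin 4, r ≠ a + 2 → MServedBelow S Z σ r → r = k

/-- the CERTIFIED pin of a partner: the pin of reading p whose sibling `n` satisfies (C1) `orb Z n`. -/
abbrev PinnedCert (orb : MCell → MCell → Prop) (C : MConfig) (Z q : MCell) (σ k f : Fin 4) : Prop :=
  ∃ n ∈ C.lower, orb Z n ∧ ∃ k' : Fin 4, k' ≠ k ∧ Sibling q n σ k' ∧ NoCompanion C q n σ k' ∧ HeOkP C Z q n σ ∧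
    HbOkP C Z n σ f

/-- **a CERTIFIED KILL** `(Z; σ, u, f)` in `S` (xrel.py safe2): the reading-p instance fires in `S` with (C1) on every sibling used and
(C2) at the pair `(σ, f)`. -/
abbrev XKillCert (orb : MCell → MCell → Prop) (S : MConfig) (Z : MCell) (σ k f : Fin 4) : Prop :=
  ¬ isApex (Z σ) ∧ σ ≠ f ∧ (∃ q ∈ S.upper, UPartner Z q σ k) ∧ WfEmpty S Z f ∧ LethalWithoutU S Z σ k f ∧
    ∀ q ∈ S.upper, UPartner Z q σ k → PinnedCert orb S Z q σ k f

/-- a certified kill is in particular a reading-p instance. -/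
theorem XKillCert.instP {orb : MCell → MCell → Prop} {S : MConfig} {Z : MCell} {σ k f : Fin 4}
    (hk : XKillCert orb S Z σ k f) : XInstP S Z σ k f := by
  obtain ⟨hch, hσf, hq, hW, -, hpin⟩ := hk
  refine ⟨hch, hσf, hq, hW, fun q hq' hqZ => ?_⟩
  obtain ⟨n, hn, -, k', hk', hs, hc, he, hb⟩ := hpin q hq' hqZ
  exact ⟨n, hn, k', hk', hs, hc, he, hb⟩

/-- `d ≥ 1` null steps in a μ₄ direction are a strictly-null-below separation. -/
theorem nullBelow_ray (y : BPoint) (k : Fin 4) {d : ℤ} (hd : 0 < d) : NullBelow y (ray y k d) := by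
  obtain ⟨y1, y2, y3⟩ := y
  refine ⟨by simp only; omega, ?_⟩
  fin_cases k <;> simp

/-- a leg is a strictly-null-below separation. -/
theorem nullBelow_of_leg {x y : BPoint} {k : Fin 4} (hlt : y.1 < x.1) (hray : x = ray y k (x.1 - y.1)) : NullBelow y x := by
  have := nullBelow_ray y k (show 0 < x.1 - y.1 by omega)
  rwa [← hray] at this

/-! ## §3 LEMMA SAFE2 -/

section Safe2

variable {orb : MCell → MCell → Prop} {T S : MConfig}

/-- **LEMMA SAFE2, `N`-side** (86089cd465aa28ed §LEMMA with §PROOF steps (1)–(3)). Let `T ⊆ S` with `T` RULE-D-closed at its `N`-cells,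
free of reading-p instances on its `N`-cells, and closed under `orb` on its `N`-cells. If a certified kill `(Z; σ, u, f)` fires in `S`,
then `Z ∉ T`. -/
theorem safe2N (hTS : T.sub S) (hD : ∀ Z ∈ T.lower, RuleDMu4N T Z)
    (hX : ∀ Z ∈ T.lower, ∀ σ k f, ¬ XInstP T Z σ k f) (hcl : ∀ Z ∈ T.lower, ∀ n, orb Z n → n ∈ T.lower)
    {Z : MCell} {σ k f : Fin 4} (hkill : XKillCert orb S Z σ k f) : Z ∉ T.lower := by
  intro hZT
  obtain ⟨hch, hσf, -, hW, ⟨a, b, ha, hb, hne, hdir⟩, hpin⟩ := hkill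
  -- (1) ABSENCE IS INHERITED: `W_f(Z) = ∅` holds in `T`
  have hW' : WfEmpty T Z f := fun P hP => hW P (hTS.2 hP)
  -- (2) A u-PARTNER SURVIVES IN `T`: RULE D at `Z` for the pair `(σ, f)` read in `T`
  have hq : ∃ q ∈ T.upper, UPartner Z q σ k := by
    rcases hD Z hZT σ f hσf a b ha hb hne with
      ⟨r, hr, hsrv⟩ | ⟨r, -, P, hP, hPf⟩ | ⟨a', b', -, -, P, hP, hag, hltσ, hrσ, hltf, hrf⟩
    · -- `(σ, a)` settled in `T` by a leg, present in `S` too: by (C2) its direction is `u`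
      obtain rfl := hdir r hr (mServedBelow_mono hTS hsrv)
      exact hsrv
    · -- a leg on `f` in `T` contradicts `W_f(Z) = ∅`
      exact absurd hPf.1 (hW' P hP (nullBelow_of_leg hPf.2.1 hPf.2.2)).1
    · -- an (r2a) cover touching `f` in `T` contradicts `W_f(Z) = ∅`
      exact absurd (nullBelow_of_leg hltσ hrσ)
        ((hW' P hP (nullBelow_of_leg hltf hrf)).2 σ hσf fun g h1 h2 => hag g h2 h1)
  -- (3) THE INSTANCE FIRES IN `T`: partners of `T` are partners of `S`, pinned there by siblings in `Z`'s orbit — present in `T` —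
  -- under absence conditions inherited by `T`
  refine hX Z hZT σ k f ⟨hch, hσf, hq, hW', fun q hq' hqZ => ?_⟩
  obtain ⟨n, -, horb, k', hk', hsib, hcomp, hHe, hHb⟩ := hpin q (hTS.2 hq') hqZ
  exact ⟨n, hcl Z hZT n horb, k', hk', hsib, fun P hP => hcomp P (hTS.2 hP), fun P hP => hHe P (hTS.2 hP),
    fun P hP => hHb P (hTS.2 hP)⟩

/-- **LEMMA SAFE2, mirror side** («the mirror case is the same argument in the dual design D^∨»; xtwo.py: mirror instances = instances
of the literal dual): with `T ⊆ S`, `T` RULE-D-closed at its `P`-cells, `T^∨` free of reading-p instances on its `N`-cells and `orb`-closed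
there, a certified kill of `P^∨` in `S^∨` gives `P ∉ T`. Uses the self-duality `ruleDMu4P_dual` of the typed RULE D. -/
theorem safe2P (h : ℤ) (hTS : T.sub S) (hD : ∀ P ∈ T.upper, RuleDMu4P T P)
    (hX : ∀ Z ∈ (T.dual h).lower, ∀ σ k f, ¬ XInstP (T.dual h) Z σ k f)
    (hcl : ∀ Z ∈ (T.dual h).lower, ∀ n, orb Z n → n ∈ (T.dual h).lower)
    {P : MCell} {σ k f : Fin 4} (hkill : XKillCert orb (S.dual h) (dualCell h P) σ k f) : P ∉ T.upper := by
  intro hPT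
  have hD' : ∀ Z ∈ (T.dual h).lower, RuleDMu4N (T.dual h) Z := fun Z hZ => by
    have := (ruleDMu4P_dual h T (dualCell h Z)).mpr (hD _ (mem_dual_lower.mp hZ))
    rwa [dualCell_dualCell] at this
  exact safe2N (dual_sub hTS) hD' hX hcl hkill (dualCell_mem_dual_lower hPT)

end Safe2

/-! ## §4 Admissible supports, certified stages, and the induction -/

/-- **an ADMISSIBLE support in the sense of the static screen** (SAFE2 §Setting): (S-i) RULE-D-closed (typed RULE D of row 771),
(S-ii±) no reading-p E− instance fires on an `N`-cell of `T` and none on an `N`-cell of the literal dual `T^∨` (the mirror instances),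
(S-iii) closed under the orbit relation `orb`, stated for `T`'s `N`-cells and for `T^∨`'s (for the engines' key `GKeyRel` the latter is
closure of `T`'s `P`-cells: `xAdmissible_of_gKeyRel`). -/
structure XAdmissible (orb : MCell → MCell → Prop) (h : ℤ) (T : MConfig) : Prop where
  /-- (S-i) -/
  ruleD : RuleDMu4Closed T
  /-- (S-ii), E− instances -/
  cleanN : ∀ Z ∈ T.lower, ∀ σ k f, ¬ XInstP T Z σ k f
  /-- (S-ii), mirror instances -/
  cleanP : ∀ Z ∈ (T.dual h).lower, ∀ σ k f, ¬ XInstP (T.dual h) Z σ k f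
  /-- (S-iii) on the `N`-cells -/
  closedN : ∀ Z ∈ T.lower, ∀ n, orb Z n → n ∈ T.lower
  /-- (S-iii) on the `N`-cells of the dual -/
  closedP : ∀ Z ∈ (T.dual h).lower, ∀ n, orb Z n → n ∈ (T.dual h).lower

/-- **one CERTIFIED STAGE `S → S′` of the alternation** (SAFE2 §certificate: «S_{n+1} = RULE-D-core of S_n minus the classes killed at
stage n», certified kills only): `S′ ⊆ S`, and every class deleted either fails RULE D in `S` or is certified-killed in `S` (an `N`-cell) ∕
in `S^∨` (a `P`-cell). Any interleaving of RULE-D deletions and kills is a sequence of such stages. -/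
structure CertStage (orb : MCell → MCell → Prop) (h : ℤ) (S S' : MConfig) : Prop where
  /-- the stage only deletes -/
  sub : S'.sub S
  /-- every deleted `N`-cell was deletable -/
  delN : ∀ Z ∈ S.lower, Z ∉ S'.lower → ¬ RuleDMu4N S Z ∨ ∃ σ k f, XKillCert orb S Z σ k f
  /-- every deleted `P`-cell was deletable -/
  delP : ∀ P ∈ S.upper, P ∉ S'.upper → ¬ RuleDMu4P S P ∨ ∃ σ k f, XKillCert orb (S.dual h) (dualCell h P) σ k f

/-- **«Consequently T ⊆ S_{n+1}»**: an admissible support inside `S` survives every certified stage `S → S′`. -/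
theorem XAdmissible.sub_of_certStage {orb : MCell → MCell → Prop} {h : ℤ} {T S S' : MConfig} (hT : XAdmissible orb h T)
    (hTS : T.sub S) (hst : CertStage orb h S S') : T.sub S' := by
  refine ⟨fun Z hZT => ?_, fun P hPT => ?_⟩
  · by_contra hZ
    rcases hst.delN Z (hTS.1 hZT) hZ with hnd | ⟨σ, k, f, hk⟩
    · exact hnd (ruleDMu4N_mono hTS (hT.ruleD.1 Z hZT))
    · exact safe2N hTS hT.ruleD.1 hT.cleanN hT.closedN hk hZT
  · by_contra hP
    rcases hst.delP P (hTS.2 hPT) hP with hnd | ⟨σ, k, f, hk⟩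
    · exact hnd (ruleDMu4P_mono hTS (hT.ruleD.2 P hPT))
    · exact safe2P h hTS hT.ruleD.2 hT.cleanP hT.closedP hk hPT

/-- **«by induction every admissible support inside S₀ is contained in the fixpoint — in whatever order certified kills are
applied»**: along ANY sequence of certified stages, an admissible support inside the start set stays inside every stage. -/
theorem XAdmissible.sub_stage {orb : MCell → MCell → Prop} {h : ℤ} {T : MConfig} (hT : XAdmissible orb h T)
    (stage : ℕ → MConfig) (hst : ∀ i, CertStage orb h (stage i) (stage (i + 1))) (h0 : T.sub (stage 0)) :
    ∀ i, T.sub (stage i)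
  | 0 => h0
  | i + 1 => hT.sub_of_certStage (XAdmissible.sub_stage hT stage hst h0 i) (hst i)

/-- admissibility for the engines' orbit key: (S-iii) = both levels of `T` closed under `GKeyRel` (the dual's closure follows from
`gKeyRel_closed_dual_lower`). -/
theorem xAdmissible_of_gKeyRel (h : ℤ) {T : MConfig} (hD : RuleDMu4Closed T)
    (hN : ∀ Z ∈ T.lower, ∀ σ k f, ¬ XInstP T Z σ k f) (hP : ∀ Z ∈ (T.dual h).lower, ∀ σ k f, ¬ XInstP (T.dual h) Z σ k f)
    (hclN : ∀ Z ∈ T.lower, ∀ n, GKeyRel Z n → n ∈ T.lower) (hclP : ∀ P ∈ T.upper, ∀ n, GKeyRel P n → n ∈ T.upper) :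
    XAdmissible GKeyRel h T :=
  ⟨hD, hN, hP, hclN, gKeyRel_closed_dual_lower h hclP⟩

/-! ## §5 Kernel probes (the predicates compute; NOT certificates about the cell's supports) -/

section Probes

/-- the `N`-cell `Z = [O|O|ℓ₋₁|6ℓ₋₁]` of the instrumented column of `Pad4TowerCrossPhase` (kit j275278). -/
def zJ : MCell := mcellOf (0, 0, 0) (0, 0, 0) (lpt 1 2) (lpt 6 2)

set_option synthInstance.maxSize 8192 in
set_option synthInstance.maxHeartbeats 2000000 in -- the unfolded predicate is one large decidable instance
/-- on the instrumented column `{Z, n = [O|O|ℓ_{−i}|6ℓ₋₁]} ∕ {q = [O|O|O|6ℓ₋₁]}` the reading-p instance `(σ, u, f) = (2, −1, 0)` fires and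
is CERTIFIED for the engines' key: the sibling `n` has `Z`'s orbit key, and the only σ-leg of `Z` present is the `u`-leg to `q`
((C2) with `(σ,a) = (2, −1)`-coordinate `2 ≠ 0 = ` the `O`-coordinate of `f`). [kernel, `decide`] -/
theorem zJ_certified : XKillCert GKeyRel j275278Column zJ 2 2 0 := by
  decide +kernel

/-- the (A1) separation: `Z = [ℓ₁|O|ℓ₋₁|6ℓ₋₁]`, its `(−1)`-partner `q = [ℓ₁|O|O|6ℓ₋₁]` on `σ = 2` with sibling `n = [ℓ₁|O|ℓ_{−i}|6ℓ₋₁]`, AND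
the (r1) partner `P″ = [O|O|ℓ₋₁|6ℓ₋₁]` of `Z` on the demand factor `f = 0`. -/
def a1Witness : MConfig where
  lower := {mcellOf (lpt 1 0) (0, 0, 0) (lpt 1 2) (lpt 6 2), mcellOf (lpt 1 0) (0, 0, 0) (lpt 1 3) (lpt 6 2)}
  upper := {mcellOf (lpt 1 0) (0, 0, 0) (0, 0, 0) (lpt 6 2), mcellOf (0, 0, 0) (0, 0, 0) (lpt 1 2) (lpt 6 2)}

/-- `a1Witness` without `P″`. -/
def a1Witness' : MConfig where
  lower := a1Witness.lower
  upper := {mcellOf (lpt 1 0) (0, 0, 0) (0, 0, 0) (lpt 6 2)}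

set_option synthInstance.maxSize 8192 in
set_option synthInstance.maxHeartbeats 2000000 in -- as above
/-- **reading p ≠ §22-verbatim, through (A1).** On `a1Witness` the verbatim predicate `XPhaseDeadMu4` FIRES at `(σ,u,f) = (2,−1,0)`
(`P″ ≰ n`, so the strong (H-b) does not see it), while the reading-p instance does NOT (`P″` is a present (r1) partner of `Z` on `f`:
`W_f(Z) ≠ ∅`); with `P″` removed both fire. [kernel, `decide`] -/
theorem instP_ne_xPhaseDeadMu4 :
    XPhaseDeadMu4 a1Witness (mcellOf (lpt 1 0) (0, 0, 0) (lpt 1 2) (lpt 6 2)) 2 2 0 ∧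
      ¬ XInstP a1Witness (mcellOf (lpt 1 0) (0, 0, 0) (lpt 1 2) (lpt 6 2)) 2 2 0 ∧
      XInstP a1Witness' (mcellOf (lpt 1 0) (0, 0, 0) (lpt 1 2) (lpt 6 2)) 2 2 0 ∧
      XPhaseDeadMu4 a1Witness' (mcellOf (lpt 1 0) (0, 0, 0) (lpt 1 2) (lpt 6 2)) 2 2 0 := by
  decide +kernel

end Probes

end Summit.Ventures.HSemireg.Pad4Tower
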